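import Mathlib
import Literature.NumberTheory.LFunctions.WeilZeroSum
import Literature.NumberTheory.LFunctions.ZetaZerosReflection
import HarnessLib

/-!
# Layers of a finite off-line zero set (helper file for stub LOC)

Route `WeilParity`, crux `OffLineParityDetection` (item stmt-RiemannHypothesis-15431), line
`registered`, stub `stub_finiteDefectLocalisation` (LOC).  Finite combinatorics of the set `S`
of off-line zeros of `ζ` in the open critical strip, assumed FINITE, with all offsets
`|Re ρ - 1/2| ≤ η₀` and top layer `T = {ζ = 0, Re = 1/2 + η₀}` (`η₀ > 0`, `T` nonempty):

* `T ⊆ S`; the reflected layer `T' = {1 - ρ̄ : ρ ∈ T} = {ζ = 0, Re = 1/2 - η₀}` is a subset of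
  `S` disjoint from `T` and in bijection with `T` (the reflection `ρ ↦ 1 - ρ̄` preserves the zero
  set, `ZetaZeros.riemannZetaNontrivialZeros.one_sub_conj_mem`);
* the remaining zeros `E = S ∖ (T ∪ T')` have offsets `≤ η'` for some `0 ≤ η' < η₀` (finitely
  many offsets, all `< η₀`);
* hence for every weight `Φ` invariant under the reflection on `T`,
  `Σ_{ρ ∈ S} Φ(ρ) = 2 Σ_{ρ ∈ T} Φ(ρ) + Σ_{ρ ∈ E} Φ(ρ)` (`loc_layers`).

No analysis and no definitions; fully proved.
-/

set_option linter.dupNamespace false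

noncomputable section

namespace Summit.RiemannHypothesis.RiemannHypothesis.Theorems.WeilParityOffLineParityDetection

open Set Filter
open scoped ComplexConjugate
open Literature.NumberTheory.LFunctions

/-- **Layer decomposition of a finite off-line zero set** (registered sub-goal of the item,
closed form).  If the set `S` of off-line zeros of `ζ` in the open strip is finite, all its
offsets are `≤ η₀` (`η₀ > 0`) and `T = {ζ = 0, Re = 1/2 + η₀}` is nonempty, then there are
`0 ≤ η' < η₀` and a sub-finset `E ⊆ S` of zeros of offset `≤ η'` such that `T ⊆ S` and
`Σ_S Φ = 2 Σ_T Φ + Σ_E Φ` for every `Φ : ℂ → ℝ` with `Φ(1 - ρ̄) = Φ(ρ)` on `T`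
(`E = S ∖ (T ∪ T')`, `T' = {1 - ρ̄ : ρ ∈ T}` the reflected layer). [folklore] -/
theorem loc_layers :
    ∀ hS : ({ρ : ℂ | riemannZeta ρ = 0 ∧ 0 < ρ.re ∧ ρ.re < 1 ∧ ρ.re ≠ 1 / 2}).Finite,
      ∀ η₀ : ℝ, 0 < η₀ →
      (∀ ρ : ℂ, riemannZeta ρ = 0 → 0 < ρ.re → ρ.re < 1 → ρ.re ≠ 1 / 2 → |ρ.re - 1 / 2| ≤ η₀) →
      ∀ T : Finset ℂ, (∀ ρ : ℂ, ρ ∈ T ↔ (riemannZeta ρ = 0 ∧ ρ.re = 1 / 2 + η₀)) → T.Nonempty →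
      ∃ η' : ℝ, 0 ≤ η' ∧ η' < η₀ ∧ ∃ E : Finset ℂ, E ⊆ hS.toFinset ∧ T ⊆ hS.toFinset ∧
        (∀ ρ ∈ E, |ρ.re - 1 / 2| ≤ η') ∧
        ∀ Φ : ℂ → ℝ, (∀ ρ ∈ T, Φ (1 - (starRingEnd ℂ) ρ) = Φ ρ) →
          ∑ ρ ∈ hS.toFinset, Φ ρ = 2 * ∑ ρ ∈ T, Φ ρ + ∑ ρ ∈ E, Φ ρ := by
  intro hS η₀ hη₀ hbound T hTmem hTne
  classical
  set ST : Finset ℂ := hS.toFinset with hST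
  -- membership bookkeeping
  have hmemS : ∀ ρ : ℂ, ρ ∈ ST ↔ riemannZeta ρ = 0 ∧ 0 < ρ.re ∧ ρ.re < 1 ∧ ρ.re ≠ 1 / 2 :=
    fun ρ ↦ by rw [hST, Set.Finite.mem_toFinset, Set.mem_setOf_eq]
  have hTfacts : ∀ ρ ∈ T, riemannZeta ρ = 0 ∧ ρ.re = 1 / 2 + η₀ ∧ ρ.re < 1 := fun ρ hρ ↦ by
    obtain ⟨hz, hre⟩ := (hTmem ρ).1 hρ
    exact ⟨hz, hre, re_lt_one_of_riemannZeta_eq_zero hz⟩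
  have hη₀half : η₀ < 1 / 2 := by
    obtain ⟨ρ, hρ⟩ := hTne
    obtain ⟨-, hre, h1⟩ := hTfacts ρ hρ
    linarith
  have hT : T ⊆ ST := fun ρ hρ ↦ by
    obtain ⟨hz, hre, h1⟩ := hTfacts ρ hρ
    exact (hmemS ρ).2 ⟨hz, by linarith, h1, by linarith⟩
  -- the reflected layer
  set σ : ℂ → ℂ := fun ρ ↦ 1 - conj ρ with hσ
  have hσσ : ∀ ρ, σ (σ ρ) = ρ := fun ρ ↦ by simp [hσ]
  have hσre : ∀ ρ, (σ ρ).re = 1 - ρ.re := fun ρ ↦ by simp [hσ]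
  have hσzero : ∀ ρ : ℂ, riemannZeta ρ = 0 → 0 < ρ.re → riemannZeta (σ ρ) = 0 := fun ρ hz h0 ↦
    ZetaZeros.riemannZetaNontrivialZeros.zeta_eq_zero
      (ZetaZeros.riemannZetaNontrivialZeros.one_sub_conj_mem
        (ZetaZeros.riemannZetaNontrivialZeros.mem_of_re_pos hz h0))
  set T' : Finset ℂ := T.image σ with hT'def
  have hT'mem : ∀ ρ : ℂ, ρ ∈ T' ↔ riemannZeta ρ = 0 ∧ ρ.re = 1 / 2 - η₀ := by
    intro ρ
    rw [hT'def, Finset.mem_image]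
    constructor
    · rintro ⟨ρ', hρ', rfl⟩
      obtain ⟨hz, hre, -⟩ := hTfacts ρ' hρ'
      exact ⟨hσzero ρ' hz (by linarith), by rw [hσre]; linarith⟩
    · rintro ⟨hz, hre⟩
      refine ⟨σ ρ, (hTmem _).2 ⟨hσzero ρ hz (by linarith), by rw [hσre]; linarith⟩, hσσ ρ⟩
  have hT' : T' ⊆ ST \ T := by
    intro ρ hρ
    obtain ⟨hz, hre⟩ := (hT'mem ρ).1 hρ
    rw [Finset.mem_sdiff]
    refine ⟨(hmemS ρ).2 ⟨hz, by linarith, by linarith, by linarith⟩, fun hρT ↦ ?_⟩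
    obtain ⟨-, hre', -⟩ := hTfacts ρ hρT
    linarith
  -- the lower layers and their maximal offset
  set E : Finset ℂ := (ST \ T) \ T' with hEdef
  set g : ℂ → ℝ := fun ρ ↦ if |ρ.re - 1 / 2| < η₀ then |ρ.re - 1 / 2| else 0 with hg
  have hSTne : ST.Nonempty := hTne.mono hT
  set η' : ℝ := ST.sup' hSTne g with hη'def
  have hg0 : ∀ ρ, 0 ≤ g ρ := fun ρ ↦ by
    simp only [hg]
    split_ifs
    · exact abs_nonneg _
    · exact le_rfl
  have hη'0 : 0 ≤ η' := by
    obtain ⟨ρ, hρ⟩ := hSTne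
    exact (hg0 ρ).trans (Finset.le_sup' g hρ)
  have hη'lt : η' < η₀ := by
    rw [hη'def, Finset.sup'_lt_iff]
    intro ρ _
    simp only [hg]
    split_ifs with h
    · exact h
    · exact hη₀
  have hEoff : ∀ ρ ∈ E, |ρ.re - 1 / 2| ≤ η' := by
    intro ρ hρ
    rw [hEdef, Finset.mem_sdiff, Finset.mem_sdiff] at hρ
    obtain ⟨⟨hρS, hρT⟩, hρT'⟩ := hρ
    obtain ⟨hz, h0, h1, hne⟩ := (hmemS ρ).1 hρS
    have hle : |ρ.re - 1 / 2| ≤ η₀ := hbound ρ hz h0 h1 hne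
    have hlt : |ρ.re - 1 / 2| < η₀ := by
      refine lt_of_le_of_ne hle fun heq ↦ ?_
      rcases le_or_gt 0 (ρ.re - 1 / 2) with hpos | hneg
      · rw [abs_of_nonneg hpos] at heq
        exact hρT ((hTmem ρ).2 ⟨hz, by linarith⟩)
      · rw [abs_of_neg hneg] at heq
        exact hρT' ((hT'mem ρ).2 ⟨hz, by linarith⟩)
    have hgρ : g ρ = |ρ.re - 1 / 2| := by simp only [hg, if_pos hlt]
    rw [← hgρ]
    exact Finset.le_sup' g hρS
  refine ⟨η', hη'0, hη'lt, E, fun ρ hρ ↦ ?_, hT, hEoff, fun Φ hΦ ↦ ?_⟩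
  · rw [hEdef, Finset.mem_sdiff, Finset.mem_sdiff] at hρ
    exact hρ.1.1
  · -- the sum identity
    have hinj : Set.InjOn σ T := fun x _ y _ hxy ↦ by
      have := congrArg σ hxy
      rwa [hσσ, hσσ] at this
    have h1 := Finset.sum_sdiff hT (f := Φ)
    have h2 := Finset.sum_sdiff hT' (f := Φ)
    have h3 : ∑ ρ ∈ T', Φ ρ = ∑ ρ ∈ T, Φ ρ := by
      rw [hT'def, Finset.sum_image hinj]
      exact Finset.sum_congr rfl fun ρ hρ ↦ hΦ ρ hρ
    rw [← h1, ← h2, h3, ← hEdef]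
    ring

end Summit.RiemannHypothesis.RiemannHypothesis.Theorems.WeilParityOffLineParityDetection

end
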